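import Summits.Ventures.LatticeQCDFlow.Exactness.IMHCoupledTimeAverageEstimator
import Summits.Ventures.LatticeQCDFlow.Exactness.IMHCoupledEstimatorReplicas
import Summits.Ventures.LatticeQCDFlow.Scoring.ReplicaChains
import HarnessLib

/-!
# A VARIANCE-DRIVEN exponential certificate for the coupled flow-MCMC estimator: the MEDIAN of `R` independent time-averaged coupled
# estimates is within `s` of `π f` except with probability `exp(−R/8)`, as soon as `4·[(2W − 1)Var_π f/L + r^k·C] ≤ s²`

HONEST FRAMING: exact (Metropolis-corrected) sampling algorithms for lattice gauge theory;
figures of merit are autocorrelation/cost numbers at stated couplings and volumes; no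
continuum-physics claim.

Venture `LatticeQCDFlow` (cell pub-lqcd), topic `Exactness`; FANOUT row 30 (lean-1, GEN-39).  NEW WORK of the cell; sequel to GEN-37's
`Exactness/IMHCoupledTimeAverageEstimator` (the time-averaged coupled estimator of ONE pair,
`H̄ = (1/L)Σ_{l<L}(f(Y_{k+l}) + Σ_{n<N} D_{k+l+n})`, has `E(H̄ − π f)² ≤ v := (2W − 1)Var_π f/L + r^k(D² + (c − a)²W(2W + 1))` from every start,
`D = max(π f − a, c − π f)`) and to the tree's median-of-replicas lemma (`Scoring/ReplicaChains`: if `R` mutually independent statistics each have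
second moment `≤ v` about `c` and `4v ≤ s²`, then at least half of them are `s`-far from `c` only with probability `≤ exp(−R/8)`).  Here, unlike the
Hoeffding bars of this generation's `…Hoeffding` ∕ `…BurnInHoeffding` whose exponent carries the RANGE `(c − a)²`, the radius is driven by the VARIANCE
`Var_π f` — the median trick in place of a Bernstein inequality («NOT CLAIMED: a variance-sensitive exponent» of those files):

* §1 (bookkeeping) **`measurable_crnLagAvg`**, **`abs_crnLagAvg_le`** — the time-averaged coupled estimate is a measurable statistic of the pair path bounded
  by `max|a||c| + N(c − a)`; **`crnLagAvg_replica_sq_le`** — its second moment about `π f` for a replica with the law of the pair chain is `≤ v`.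
* §2 **`crnLagAvg_replicas_median_certificate`** — THE CERTIFICATE: `Z_0, …` mutually independent pair streams from ONE initial coupling, `s > 0` with
  `4v ≤ s²`; then `P(#{r < R : |H̄(Z_r) − π f| ≥ s} ≥ R/2) ≤ exp(−R/8)` — on the complement every sample median of `H̄(Z_0), …, H̄(Z_{R−1})` lies in
  `(π f − s, π f + s)`.  In numbers: `L = ⌈8(2W − 1)Var_π f/s²⌉`, `k = ⌈W·log(8(D² + (c − a)²W(2W + 1))/s²)⌉`, `R = ⌈8 log(1/δ)⌉` certify the median to
  accuracy `s` at confidence `1 − δ` — a budget `∝ W·Var_π f·log(1/δ)/s²` update rounds, VARIANCE- not range-driven;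
  **`crnLagAvg_replicas_median_certificate_of_le`** — the same with the two conditions `8(2W − 1)Var_π f ≤ L s²` and `8 r^k(D² + (c − a)²W(2W + 1)) ≤ s²` spelled out.
Reading (gauge files): the median of `R` independent time-averaged coupled estimates of two exact gauge samplers is an exponentially reliable estimate of
`π f` whose window only needs to beat the equilibrium variance `(2/A − 1)Var_π f`, not the observable's range.
NOT CLAIMED: the constants `8`, `1/8` are not optimised; a Bernstein inequality proper; anything for unbounded `f`; any value of `A`.  No `sorry`, no new
definitions, nothing cited as a fact.
-/

noncomputable section

namespace Summit.Ventures.LatticeQCDFlow.Exactness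

open MeasureTheory ProbabilityTheory Function Finset Filter
open scoped ENNReal unitInterval Topology
open Summit.Ventures.LatticeQCDFlow.Scoring

variable {Ω : Type*} [MeasurableSpace Ω] {q : Measure Ω} [IsProbabilityMeasure q] {w : Ω → ℝ}

/-! ## §1 The time-averaged coupled estimate as a bounded measurable statistic of the pair path -/

omit [IsProbabilityMeasure q] in
/-- Measurability of `z ↦ (1/L)Σ_{l<L}(f((z(k+l)).2) + Σ_{n<N}(f((z(k+l+n)).1) − f((z(k+l+n)).2)))`. [ours, bookkeeping] -/
theorem measurable_crnLagAvg {f : Ω → ℝ} (hf : Measurable f) (k N L : ℕ) :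
    Measurable fun z : ℕ → Ω × Ω => (∑ l ∈ Finset.range L, (f ((z (k + l)).2) +
      ∑ n ∈ Finset.range N, (f ((z (k + l + n)).1) - f ((z (k + l + n)).2)))) / L :=
  (Finset.measurable_sum _ fun _ _ => (hf.comp (measurable_snd.comp (measurable_pi_apply _))).add
    (Finset.measurable_sum _ fun _ _ => (hf.comp (measurable_fst.comp (measurable_pi_apply _))).sub
      (hf.comp (measurable_snd.comp (measurable_pi_apply _))))).div_const _

omit [MeasurableSpace Ω] [IsProbabilityMeasure q] in
/-- `|H̄(z)| ≤ max|a||c| + N(c − a)` for `a ≤ f ≤ c`. [ours, bookkeeping] -/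
theorem abs_crnLagAvg_le {f : Ω → ℝ} {a c : ℝ} (ha : ∀ x, a ≤ f x) (hc : ∀ x, f x ≤ c) (k N L : ℕ) (z : ℕ → Ω × Ω) :
    |(∑ l ∈ Finset.range L, (f ((z (k + l)).2) + ∑ n ∈ Finset.range N, (f ((z (k + l + n)).1) - f ((z (k + l + n)).2)))) / L| ≤
      max |a| |c| + N * (c - a) := by
  have hB : 0 ≤ max |a| |c| + N * (c - a) := by
    have h1 : 0 ≤ max |a| |c| := le_max_of_le_left (abs_nonneg a)
    rcases Nat.eq_zero_or_pos N with h0 | hpos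
    · rw [h0, Nat.cast_zero, zero_mul, add_zero]; exact h1
    · have hca : a ≤ c := (ha (z 0).1).trans (hc (z 0).1)
      nlinarith [Nat.cast_nonneg (α := ℝ) N]
  rcases Nat.eq_zero_or_pos L with hL | hL
  · rw [hL]; simp only [Finset.range_zero, Finset.sum_empty, Nat.cast_zero, div_zero, abs_zero]; exact hB
  have hLpos : (0 : ℝ) < L := Nat.cast_pos.2 hL
  have hterm : ∀ l, |f ((z (k + l)).2) + ∑ n ∈ Finset.range N, (f ((z (k + l + n)).1) - f ((z (k + l + n)).2))| ≤
      max |a| |c| + N * (c - a) := fun l => by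
    have h := abs_crnLagEstimator_le ha hc (k + l) N z
    simpa only [Nat.add_assoc] using h
  rw [abs_div, abs_of_pos hLpos, div_le_iff₀ hLpos]
  calc |∑ l ∈ Finset.range L, (f ((z (k + l)).2) + ∑ n ∈ Finset.range N, (f ((z (k + l + n)).1) - f ((z (k + l + n)).2)))|
      ≤ ∑ l ∈ Finset.range L, |f ((z (k + l)).2) + ∑ n ∈ Finset.range N, (f ((z (k + l + n)).1) - f ((z (k + l + n)).2))| :=
        abs_sum_le_sum_abs _ _
    _ ≤ ∑ l ∈ Finset.range L, (max |a| |c| + N * (c - a)) := sum_le_sum fun l _ => hterm l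
    _ = (max |a| |c| + N * (c - a)) * L := by rw [sum_const, card_range, nsmul_eq_mul, mul_comm]

section Replicas

variable {Ω' : Type*} {mΩ' : MeasurableSpace Ω'} {μ : Measure Ω'} [IsProbabilityMeasure μ]
  {Z : ℕ → Ω' → (ℕ → Ω × Ω)}

omit [IsProbabilityMeasure μ] in
/-- **PER REPLICA: `E(H̄(Z_r) − π f)² ≤ (2W − 1)Var_π f/L + r^k(D² + (c − a)²W(2W + 1))`** for a stream with the law of the pair chain (transfer of GEN-37's
`crnLagAvg_sq_le_explicit`). [ours, bookkeeping] -/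
theorem crnLagAvg_replica_sq_le [Fact (Measurable w)] (hw0 : ∀ y, 0 < w y) {x₀ : Ω} (hmax : ∀ y, w y ≤ w x₀)
    [IsProbabilityMeasure (q.withDensity fun y => ENNReal.ofReal (w y))]
    (Khat : Kernel (Ω × Ω) (Ω × Ω)) [IsMarkovKernel Khat]
    (hK : ∀ z : Ω × Ω, Khat z = (q.prod (volume : Measure unitInterval)).map (fun p : Ω × unitInterval =>
      ((if (p.2 : ℝ) * w z.1 ≤ w p.1 then p.1 else z.1), (if (p.2 : ℝ) * w z.2 ≤ w p.1 then p.1 else z.2))))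
    (ν : Measure (Ω × Ω)) [IsProbabilityMeasure ν] {f : Ω → ℝ} (hf : Measurable f) {a c : ℝ} (ha : ∀ x, a ≤ f x)
    (hc : ∀ x, f x ≤ c) (k N : ℕ) {L : ℕ} (hL : L ≠ 0) (hZm : ∀ j, Measurable (Z j)) {r : ℕ}
    (hlaw : μ.map (Z r) = Kernel.trajMeasure (X := fun _ : ℕ => Ω × Ω) ν
      (fun n : ℕ => Khat.comap (fun h : (i : ↥(Finset.Iic n)) → Ω × Ω => h ⟨n, Finset.mem_Iic.2 le_rfl⟩)
        (measurable_pi_apply _))) :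
    ∫ ω, ((∑ l ∈ Finset.range L, (f ((Z r ω (k + l)).2) +
        ∑ n ∈ Finset.range N, (f ((Z r ω (k + l + n)).1) - f ((Z r ω (k + l + n)).2)))) / L -
          ∫ x, f x ∂(q.withDensity fun y => ENNReal.ofReal (w y))) ^ 2 ∂μ ≤
      (2 * w x₀ - 1) * (∫ x, (f x - ∫ z, f z ∂(q.withDensity fun y => ENNReal.ofReal (w y))) ^ 2
          ∂(q.withDensity fun y => ENNReal.ofReal (w y))) / L +
        (1 - (w x₀)⁻¹) ^ k * (max (∫ z, f z ∂(q.withDensity fun y => ENNReal.ofReal (w y)) - a)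
            (c - ∫ z, f z ∂(q.withDensity fun y => ENNReal.ofReal (w y))) ^ 2 + (c - a) ^ 2 * (w x₀ * (2 * w x₀ + 1))) := by
  have hφ : Measurable fun z : ℕ → Ω × Ω => ((∑ l ∈ Finset.range L, (f ((z (k + l)).2) +
      ∑ n ∈ Finset.range N, (f ((z (k + l + n)).1) - f ((z (k + l + n)).2)))) / L -
        ∫ x, f x ∂(q.withDensity fun y => ENNReal.ofReal (w y))) ^ 2 :=
    ((measurable_crnLagAvg hf k N L).sub_const _).pow_const 2
  rw [integral_comp_eq_of_map_eq (hZm r) hlaw hφ]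
  exact crnLagAvg_sq_le_explicit hw0 hmax Khat hK ν hf ha hc k N hL

/-! ## §2 The median certificate -/

/-- **THE MEDIAN-OF-COUPLED-AVERAGES CERTIFICATE.**  `w` a `Fact`-measurable normalised weight maximal at `x₀` (`W = w(x₀)`, `r = 1 − 1/W`); `K̂` a CRN pair
kernel; `Z_0, Z_1, …` MUTUALLY independent pair streams from ONE initial coupling `ν̂`; `a ≤ f ≤ c` measurable; window `L ≠ 0`, burn-in `k`, truncation `N`;
`v = (2W − 1)Var_π f/L + r^k(D² + (c − a)²W(2W + 1))`; radius `s > 0` with `4v ≤ s²`.  Then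
`P(#{r < R : |H̄(Z_r) − π f| ≥ s} ≥ R/2) ≤ exp(−R/8)`: every sample median of the `R` time-averaged coupled estimates lies within `s` of `π f` except with
probability `exp(−R/8)`. [ours — the tree's median-of-replicas lemma applied] -/
theorem crnLagAvg_replicas_median_certificate [Fact (Measurable w)] (hw0 : ∀ y, 0 < w y) {x₀ : Ω} (hmax : ∀ y, w y ≤ w x₀)
    [IsProbabilityMeasure (q.withDensity fun y => ENNReal.ofReal (w y))]
    (Khat : Kernel (Ω × Ω) (Ω × Ω)) [IsMarkovKernel Khat]
    (hK : ∀ z : Ω × Ω, Khat z = (q.prod (volume : Measure unitInterval)).map (fun p : Ω × unitInterval =>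
      ((if (p.2 : ℝ) * w z.1 ≤ w p.1 then p.1 else z.1), (if (p.2 : ℝ) * w z.2 ≤ w p.1 then p.1 else z.2))))
    (ν : Measure (Ω × Ω)) [IsProbabilityMeasure ν] {f : Ω → ℝ} (hf : Measurable f) {a c : ℝ} (ha : ∀ x, a ≤ f x)
    (hc : ∀ x, f x ≤ c) (k N : ℕ) {L : ℕ} (hL : L ≠ 0) (hZm : ∀ j, Measurable (Z j))
    (hlaw : ∀ j, μ.map (Z j) = Kernel.trajMeasure (X := fun _ : ℕ => Ω × Ω) ν
      (fun n : ℕ => Khat.comap (fun h : (i : ↥(Finset.Iic n)) → Ω × Ω => h ⟨n, Finset.mem_Iic.2 le_rfl⟩)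
        (measurable_pi_apply _)))
    (hind : iIndepFun Z μ) (R : ℕ) {s : ℝ} (hs : 0 < s)
    (hvs : 4 * ((2 * w x₀ - 1) * (∫ x, (f x - ∫ z, f z ∂(q.withDensity fun y => ENNReal.ofReal (w y))) ^ 2
          ∂(q.withDensity fun y => ENNReal.ofReal (w y))) / L +
        (1 - (w x₀)⁻¹) ^ k * (max (∫ z, f z ∂(q.withDensity fun y => ENNReal.ofReal (w y)) - a)
            (c - ∫ z, f z ∂(q.withDensity fun y => ENNReal.ofReal (w y))) ^ 2 + (c - a) ^ 2 * (w x₀ * (2 * w x₀ + 1)))) ≤ s ^ 2) :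
    μ.real {ω | (R : ℝ) / 2 ≤ #{r ∈ range R | s ≤ |(∑ l ∈ Finset.range L, (f ((Z r ω (k + l)).2) +
        ∑ n ∈ Finset.range N, (f ((Z r ω (k + l + n)).1) - f ((Z r ω (k + l + n)).2)))) / L -
          ∫ x, f x ∂(q.withDensity fun y => ENNReal.ofReal (w y))|}} ≤ Real.exp (-(R / 8)) := by
  have hYm : ∀ r, Measurable fun ω => (∑ l ∈ Finset.range L, (f ((Z r ω (k + l)).2) +
      ∑ n ∈ Finset.range N, (f ((Z r ω (k + l + n)).1) - f ((Z r ω (k + l + n)).2)))) / L :=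
    fun r => (measurable_crnLagAvg hf k N L).comp (hZm r)
  have hY2 : ∀ r < R, MemLp (fun ω => (∑ l ∈ Finset.range L, (f ((Z r ω (k + l)).2) +
      ∑ n ∈ Finset.range N, (f ((Z r ω (k + l + n)).1) - f ((Z r ω (k + l + n)).2)))) / L) 2 μ := fun r _ =>
    MemLp.of_bound (hYm r).aestronglyMeasurable (max |a| |c| + N * (c - a)) (ae_of_all _ fun ω => by
      rw [Real.norm_eq_abs]; exact abs_crnLagAvg_le ha hc k N L (Z r ω))
  have hind' : iIndepFun (fun r ω => (∑ l ∈ Finset.range L, (f ((Z r ω (k + l)).2) +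
      ∑ n ∈ Finset.range N, (f ((Z r ω (k + l + n)).1) - f ((Z r ω (k + l + n)).2)))) / L) μ :=
    hind.comp (fun _ => _) fun _ => measurable_crnLagAvg hf k N L
  exact measureReal_half_replicas_far_le_of_sq hind' hYm hY2 hs hvs
    (fun r _ => crnLagAvg_replica_sq_le hw0 hmax Khat hK ν hf ha hc k N hL hZm (hlaw r))

/-- **THE CERTIFICATE WITH THE TWO CONDITIONS SPELLED OUT**: `8(2W − 1)Var_π f ≤ L·s²` (window beats the equilibrium variance) and
`8 r^k(D² + (c − a)²W(2W + 1)) ≤ s²` (burn-in beats the start-up term) ⇒ `P(#{r < R : |H̄(Z_r) − π f| ≥ s} ≥ R/2) ≤ exp(−R/8)`; with `R ≥ 8 log(1/δ)` the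
right side is `≤ δ`. [ours] -/
theorem crnLagAvg_replicas_median_certificate_of_le [Fact (Measurable w)] (hw0 : ∀ y, 0 < w y) {x₀ : Ω} (hmax : ∀ y, w y ≤ w x₀)
    [IsProbabilityMeasure (q.withDensity fun y => ENNReal.ofReal (w y))]
    (Khat : Kernel (Ω × Ω) (Ω × Ω)) [IsMarkovKernel Khat]
    (hK : ∀ z : Ω × Ω, Khat z = (q.prod (volume : Measure unitInterval)).map (fun p : Ω × unitInterval =>
      ((if (p.2 : ℝ) * w z.1 ≤ w p.1 then p.1 else z.1), (if (p.2 : ℝ) * w z.2 ≤ w p.1 then p.1 else z.2))))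
    (ν : Measure (Ω × Ω)) [IsProbabilityMeasure ν] {f : Ω → ℝ} (hf : Measurable f) {a c : ℝ} (ha : ∀ x, a ≤ f x)
    (hc : ∀ x, f x ≤ c) (k N : ℕ) {L : ℕ} (hL : L ≠ 0) (hZm : ∀ j, Measurable (Z j))
    (hlaw : ∀ j, μ.map (Z j) = Kernel.trajMeasure (X := fun _ : ℕ => Ω × Ω) ν
      (fun n : ℕ => Khat.comap (fun h : (i : ↥(Finset.Iic n)) → Ω × Ω => h ⟨n, Finset.mem_Iic.2 le_rfl⟩)
        (measurable_pi_apply _)))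
    (hind : iIndepFun Z μ) (R : ℕ) {s : ℝ} (hs : 0 < s)
    (hLs : 8 * ((2 * w x₀ - 1) * ∫ x, (f x - ∫ z, f z ∂(q.withDensity fun y => ENNReal.ofReal (w y))) ^ 2
          ∂(q.withDensity fun y => ENNReal.ofReal (w y))) ≤ L * s ^ 2)
    (hks : 8 * ((1 - (w x₀)⁻¹) ^ k * (max (∫ z, f z ∂(q.withDensity fun y => ENNReal.ofReal (w y)) - a)
            (c - ∫ z, f z ∂(q.withDensity fun y => ENNReal.ofReal (w y))) ^ 2 + (c - a) ^ 2 * (w x₀ * (2 * w x₀ + 1)))) ≤ s ^ 2) :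
    μ.real {ω | (R : ℝ) / 2 ≤ #{r ∈ range R | s ≤ |(∑ l ∈ Finset.range L, (f ((Z r ω (k + l)).2) +
        ∑ n ∈ Finset.range N, (f ((Z r ω (k + l + n)).1) - f ((Z r ω (k + l + n)).2)))) / L -
          ∫ x, f x ∂(q.withDensity fun y => ENNReal.ofReal (w y))|}} ≤ Real.exp (-(R / 8)) := by
  refine crnLagAvg_replicas_median_certificate hw0 hmax Khat hK ν hf ha hc k N hL hZm hlaw hind R hs ?_
  have hLpos : (0 : ℝ) < L := Nat.cast_pos.2 (Nat.pos_of_ne_zero hL)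
  have h1 : 4 * ((2 * w x₀ - 1) * (∫ x, (f x - ∫ z, f z ∂(q.withDensity fun y => ENNReal.ofReal (w y))) ^ 2
      ∂(q.withDensity fun y => ENNReal.ofReal (w y))) / L) ≤ s ^ 2 / 2 := by
    rw [mul_div_assoc', div_le_iff₀ hLpos]
    linarith
  linarith

end Replicas

end Summit.Ventures.LatticeQCDFlow.Exactness

end
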